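import Summits.HodgeConjecture.HodgeConjecture.Theorems.F0P3XiEvpOfRecordSC            -- ★ p840437 (A2): `xiEvpOfRecordSC`, bridges; ★ p840408 (A1): `xiPacketFamilyOfRecordSC`
import Summits.HodgeConjecture.HodgeConjecture.Theorems.F0P3LettersXiLocalPacketUnitary -- ★ (F0P3-p01 (g8)): `XiLocalPacketUnitary` (+ ★ K0 `kitOfRecord`, `XiSide`, laws V6, ★ `xiSideOfRecord`)
import HarnessLib

/-!
# THE ξ-SIDE OF RECORD ON SUPERCUSPIDAL PARTNER DATA `ξd₀ˢᶜ = xiSideOfRecordSC …` (`…SC` twins of ★ `F0P3XiSideOfRecord` + ★ `F0P3LettersXiLocalPacketUnitary` §2)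

Cell `hodgecm-mathlib`, F0∕P3 «U3-mult», crux H413 (`stmt-HodgeConjecture-24833`); LEAD F0P3a-plan (g9) T8-23 (A) «R4-SC» module B1, desk F0P3-plan (g8) D19
ADDENDUM (A) branch (α-SC) (F0P3a-p01 (g11), 2026-09-01).  DEF LANE: ONE definition (`xiSideOfRecordSC`) + `rfl` read-backs + theorems; no instance, no notation,
no named fact, no `sorry`.

The K0 parameter `ξd : XiSide L H PG PH` of ★ `kitOfRecord` built from the SC record: `ram := ramOfRecord₂ … (hexc ξ)` (★, hCM-free), `tXi := xiEvpOfRecordSC …`,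
`packFin := xiPacketFamilyOfRecordSC …`; the three ξ-laws `XiFamilyFin` ∕ `XiUnram` ∕ `EvpConvention` AT `𝔠₀ˢᶜ = kitOfRecord … ξd₀ˢᶜ …` and row #21 with the letter (L-i′)
BY NAME; and F0P3b's `hFinU` binder at `ξd₀ˢᶜ` from the letter ★ `XiLocalPacketUnitary` — all ★ texts TOKEN FOR TOKEN with `hCM ↦ hSC` (the supercuspidal partner
datum of ★ A1), explicit telescope = the ★ one minus `Δ mH mG νG νH ξloc`.  CLOSER USE (ED. 19b branch (α), pen F0P3-p04 (g10)): `xiSideOfRecord L H hH hHd μω hμu Δfin mH mG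
νG νH ξloc μZ keys (hCM_of_cmCharIdentityPackage … hQ) hexc μv …` ↦ `xiSideOfRecordSC L H hH hHd μω hμu μZ keys (hSC_of_cmCharIdentityPackage[Test] … hQ[T]) hexc μv …`;
`xiUnram_kitOfRecord_of_xiPinSphericalCofinite ↦ xiUnram_kitOfRecordSC_of_xiPinSphericalCofinite`, `hFinU_xiSideOfRecord ↦ hFinU_xiSideOfRecordSC` (same pruning).

References: [Rogawski1990] §12.2 (1)–(2) pp. 173–174, §13.1 Prop. 13.1.3 (d) p. 199, §13.3 Thm. 13.3.6 (b) p. 202, §13.7 p. 206; [CartierCorvallis1979] §IV.1 Cor. 4.1.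
HC_CM is proved only modulo the printed citations until rung 0 closes.
-/

set_option autoImplicit false
set_option linter.dupNamespace false

noncomputable section

open NumberField IsDedekindDomain MeasureTheory
open Literature.NumberTheory.Rogawski1990 Literature.NumberTheory.GaloisRepresentations
open Literature.NumberTheory.Automorphic Literature.NumberTheory.Automorphic.UnitaryGroup
open scoped Matrix

namespace Summit.HodgeConjecture.HodgeConjecture.Cruxes.H413.F0P3XiSideOfRecordSC

open Summit.HodgeConjecture.HodgeConjecture.Cruxes.H413.F0P3InnerFormClassificationV6
open Summit.HodgeConjecture.HodgeConjecture.Cruxes.H413.F0P3KitOfRecord (kitOfRecord XiSide GHSide)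
open Summit.HodgeConjecture.HodgeConjecture.Cruxes.H413.F0P3XiPacketFamilyOfRecord
open Summit.HodgeConjecture.HodgeConjecture.Cruxes.H413.F0P3XiPacketFamilyOfRecordSC
open Summit.HodgeConjecture.HodgeConjecture.Cruxes.H413.F0P3ClassTokenChoice (isUnitarizable_comap)
open Summit.HodgeConjecture.HodgeConjecture.Cruxes.H413.F0P3LettersXiLocalPacketUnitary (XiLocalPacketUnitary)

section Side

variable (L : Type) [Field L] [NumberField L] [IsCMField L] (H : Matrix (Fin 3) (Fin 3) L)

/-! ## §1 The binders of the ξ-local family of record (`MEMO-K0-xi-fields` §0) -/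

variable (hH : (H.map (cmConjRingHom L))ᵀ = H) (hHd : IsUnit H.det) (μω : HeckeCharacter L) (hμu : μω.IsUnitary)
  [∀ v : HeightOneSpectrum (𝓞 ↥(maximalRealSubfield L)), MeasurableSpace (Gqs L v ⧸ Subgroup.center (Gqs L v))]
  (μZ : ∀ v : HeightOneSpectrum (𝓞 ↥(maximalRealSubfield L)), Measure (Gqs L v ⧸ Subgroup.center (Gqs L v)))
  (keys : ∀ (ξ : OneDimAutRepH L) (v : HeightOneSpectrum (𝓞 ↥(maximalRealSubfield L))),
    (∀ w : PlacesOver L v, IsCMField.complexConj L • w.1 = w.1) →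
      {p : IrrClass (Gqs L v) × IrrClass (Gqs L v) //
        KeysCaseTwoLabels L v (μω.semilocalComponent L v) (torusLocalComponent L (IsCMField.complexConj L) v ξ.η)
          (torusLocalComponent L (IsCMField.complexConj L) v ξ.ψ) p.1 p.2 ∧
        p.1.IsSquareIntegrable (μZ v) ∧ ¬ p.2.IsSquareIntegrable (μZ v)})
  (hSC : letI : ∀ v : HeightOneSpectrum (𝓞 ↥(maximalRealSubfield L)), MeasurableSpace ((cmDatum L 3 H).Local v) := fun _ => borel _
    ∀ (ξ : OneDimAutRepH L) (v : HeightOneSpectrum (𝓞 ↥(maximalRealSubfield L)))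
    (hns : ∀ w : PlacesOver L v, IsCMField.complexConj L • w.1 = w.1)
    (T : GL (Fin 3) (LocalRing L v)) (a : LocalRing L v) (ha : IsUnit a)
    (h : formCongr (conjLocal L (IsCMField.complexConj L) v) T (H.map (algebraMap L (LocalRing L v))) =
      a • (Matrix.of fun i j : Fin 3 => if i.val + j.val + 1 = 3 then (1 : L) else 0).map (algebraMap L (LocalRing L v)))
    (π2 πn : IrrClass (Gqs L v)),
    KeysCaseTwoLabels L v (μω.semilocalComponent L v) (torusLocalComponent L (IsCMField.complexConj L) v ξ.η)
      (torusLocalComponent L (IsCMField.complexConj L) v ξ.ψ) π2 πn → ¬ πn.IsSquareIntegrable (μZ v) →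
    ∃ πs : IrrClass ((cmDatum L 3 H).Local v), πs.IsSupercuspidal ∧ πs ≠ IrrClass.comap (cmDatumLocalCongr L v T ha h).symm πn)
  (hexc : ∀ ξ : OneDimAutRepH L, ∀ᶠ v : HeightOneSpectrum (𝓞 ↥(maximalRealSubfield L)) in Filter.cofinite,
      ∀ hns : ∀ w : PlacesOver L v, IsCMField.complexConj L • w.1 = w.1,
        ((keys ξ v hns).1.2).IsSpherical (cmLocalIntegralLevel L 3 (qsForm L) v))
  (μv : ∀ v : Places L, @Measure ((cmDatum L 3 H).Local v) (borel _))
  {PG PH : Type} (evpG : PG → EvpData L H) (evpH : PH → EvpData L H) (ramG : PG → Finset (Places L)) (ramH : PH → Finset (Places L))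
  (PiXi : OneDimAutRepH L → PG) (ρXi : OneDimAutRepH L → PH)

/-! ## §2 `ξd₀ = xiSideOfRecordSC …` -/

/-- **`xiSideOfRecordSC … : XiSide L H PG PH` — THE ξ-SIDE OF RECORD** for K0's `kitOfRecord`: (J2) packet data `evpG evpH ramG ramH PiXi ρXi` as given;
`ram := ramOfRecord₂ … (hexc ξ)`, `tXi := xiEvpOfRecordSC … μv`, `packFin := xiPacketFamilyOfRecordSC …` (★ p819729 ∕ p820295 ∕ p819611).
[cite: Rogawski1990, §12.2 (2) pp. 173–174; §13.1 p. 199; §13.7 p. 206] -/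
def xiSideOfRecordSC : XiSide L H PG PH :=
  letI : ∀ v : HeightOneSpectrum (𝓞 ↥(maximalRealSubfield L)), MeasurableSpace ((cmDatum L 3 H).Local v) := fun _ => borel _
  { evpG := evpG, evpH := evpH, ramG := ramG, ramH := ramH, PiXi := PiXi, ρXi := ρXi
    ram := fun ξ => ramOfRecord₂ L H hH hHd μω μZ keys ξ (hexc ξ)
    tXi := xiEvpOfRecordSC L H hH hHd μω hμu μZ keys hSC μv
    packFin := xiPacketFamilyOfRecordSC L H hH hHd μω hμu μZ keys hSC }

/-- `ξd₀.ram ξ = ramOfRecord₂ … ξ (hexc ξ)`. [cite: Rogawski1990, §13.3 Thm. 13.3.6 (b) p. 202] -/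
theorem xiSideOfRecordSC_ram (ξ : OneDimAutRepH L) :
    (xiSideOfRecordSC L H hH hHd μω hμu μZ keys hSC hexc μv evpG evpH ramG ramH PiXi ρXi).ram ξ =
      ramOfRecord₂ L H hH hHd μω μZ keys ξ (hexc ξ) :=
  rfl

/-- `ξd₀.tXi = xiEvpOfRecordSC … μv`. [cite: Rogawski1990, §13.7 p. 206] -/
theorem xiSideOfRecordSC_tXi :
    (xiSideOfRecordSC L H hH hHd μω hμu μZ keys hSC hexc μv evpG evpH ramG ramH PiXi ρXi).tXi =
      (letI : ∀ v : HeightOneSpectrum (𝓞 ↥(maximalRealSubfield L)), MeasurableSpace ((cmDatum L 3 H).Local v) := fun _ => borel _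
       xiEvpOfRecordSC L H hH hHd μω hμu μZ keys hSC μv) :=
  rfl

/-- `ξd₀.packFin = xiPacketFamilyOfRecordSC …`. [cite: Rogawski1990, §13.1 p. 199] -/
theorem xiSideOfRecordSC_packFin :
    (xiSideOfRecordSC L H hH hHd μω hμu μZ keys hSC hexc μv evpG evpH ramG ramH PiXi ρXi).packFin =
      (letI : ∀ v : HeightOneSpectrum (𝓞 ↥(maximalRealSubfield L)), MeasurableSpace ((cmDatum L 3 H).Local v) := fun _ => borel _
       xiPacketFamilyOfRecordSC L H hH hHd μω hμu μZ keys hSC) :=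
  rfl

/-- The (J2) packet data pass through unchanged: `ξd₀.PiXi = PiXi`. [cite: Rogawski1990, §13.1 p. 199] -/
theorem xiSideOfRecordSC_PiXi : (xiSideOfRecordSC L H hH hHd μω hμu μZ keys hSC hexc μv evpG evpH ramG ramH PiXi ρXi).PiXi = PiXi := rfl

/-- `ξd₀.ρXi = ρXi`. [cite: Rogawski1990, §13.1 p. 199] -/
theorem xiSideOfRecordSC_ρXi : (xiSideOfRecordSC L H hH hHd μω hμu μZ keys hSC hexc μv evpG evpH ramG ramH PiXi ρXi).ρXi = ρXi := rfl

/-- `ξd₀.evpG = evpG`. [cite: Rogawski1990, §13.7 p. 206] -/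
theorem xiSideOfRecordSC_evpG : (xiSideOfRecordSC L H hH hHd μω hμu μZ keys hSC hexc μv evpG evpH ramG ramH PiXi ρXi).evpG = evpG := rfl

/-- `ξd₀.evpH = evpH`. [cite: Rogawski1990, §13.7 p. 206] -/
theorem xiSideOfRecordSC_evpH : (xiSideOfRecordSC L H hH hHd μω hμu μZ keys hSC hexc μv evpG evpH ramG ramH PiXi ρXi).evpH = evpH := rfl

/-! ## §3 The three ξ-laws AT `𝔠₀ = kitOfRecord … ξd₀ …` -/

section Laws

variable (ι : L →+* ℂ) (T : GL (Fin 3) ℂ)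
  (hT : (T : Matrix (Fin 3) (Fin 3) ℂ)ᴴ * H.map ι * (T : Matrix (Fin 3) (Fin 3) ℂ) = Literature.Geometry.ComplexHyperbolic.BallModel.J)
  (μ : Measure (Gp L H).automorphicQuotient) [(Gp L H).IsAutomorphicMeasure μ]
  [MeasurableSpace (Gp L H).Adelic] [BorelSpace (Gp L H).Adelic]
  (𝔰 : Sockets L H μ) (gh : GHSide L H ι T hT 𝔰.PacketG 𝔰.PacketH)
  (evpG' : 𝔰.PacketG → EvpData L H) (evpH' : 𝔰.PacketH → EvpData L H) (ramG' : 𝔰.PacketG → Finset (Places L)) (ramH' : 𝔰.PacketH → Finset (Places L))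
  (PiXi' : OneDimAutRepH L → 𝔰.PacketG) (ρXi' : OneDimAutRepH L → 𝔰.PacketH)
  (c : ℚ) (jInf dsInf : ℤ → ℤ → ℤ → Cinf)
  (archTr : Cinf → (UnitaryGroup.arch (↥(maximalRealSubfield L)) L (IsCMField.complexConj L) 3 H → ℂ) → ℂ)
  (ν : Measure (Gp L H).Adelic) [IsFiniteMeasureOnCompacts ν]
  (ramCls₀ : DiscreteAutomorphicRep (Gp L H) μ → Set (Places L))

/-- **Row #20 — law `XiFamilyFin μω hμu` AT `𝔠₀`, a THEOREM**: the finite packets of record form a ξ-local family (★ `isXiLocalFamily_xiPacketFamilyOfRecordSC`; the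
frame terms of v6 `XiFamilyFin` match `hH hHd` by proof irrelevance). [cite: Rogawski1990, §13.1 Prop. 13.1.3 (d) p. 199; §12.2 (2) pp. 173–174] -/
theorem xiFamilyFin_kitOfRecordSC :
    (kitOfRecord L H ι T hT μ 𝔰 gh
      (xiSideOfRecordSC L H hH hHd μω hμu μZ keys hSC hexc μv evpG' evpH' ramG' ramH' PiXi' ρXi')
      μω c jInf dsInf archTr ν μv ramCls₀).XiFamilyFin μω hμu := by
  letI : ∀ v : HeightOneSpectrum (𝓞 ↥(maximalRealSubfield L)), MeasurableSpace ((cmDatum L 3 H).Local v) := fun _ => borel _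
  exact isXiLocalFamily_xiPacketFamilyOfRecordSC L H hH hHd μω hμu μZ keys hSC

/-- **Row #21 — law `XiUnram` AT `𝔠₀`** (any `hexc`), given that the kit's measures `μv v` are Haar (pin (iii) data): off `ram₀ ξ` the member `πⁿ` of record is
`K_v`-spherical WITH `tXi₀ ξ v` and admissible (★ `xiUnram_xiEvpOfRecordSC`). [cite: Rogawski1990, §12.2 pp. 173–174; §13.7 p. 206] [cite: CartierCorvallis1979, §IV.1 Cor. 4.1] -/
theorem xiUnram_kitOfRecordSC
    (hμv : ∀ v : Places L, letI : MeasurableSpace ((cmDatum L 3 H).Local v) := borel _; (μv v).IsHaarMeasure) :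
    (kitOfRecord L H ι T hT μ 𝔰 gh
      (xiSideOfRecordSC L H hH hHd μω hμu μZ keys hSC hexc μv evpG' evpH' ramG' ramH' PiXi' ρXi')
      μω c jInf dsInf archTr ν μv ramCls₀).XiUnram := by
  intro ξ v hv
  letI : ∀ v : HeightOneSpectrum (𝓞 ↥(maximalRealSubfield L)), MeasurableSpace ((cmDatum L 3 H).Local v) := fun _ => borel _
  haveI : BorelSpace ((cmDatum L 3 H).Local v) := ⟨rfl⟩
  haveI : (μv v).IsHaarMeasure := hμv v
  exact xiUnram_xiEvpOfRecordSC L H hH hHd μω hμu μZ keys hSC μv ξ (hexc := hexc ξ) v hv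

/-- **Row #23 — law `EvpConvention` AT `𝔠₀`**: the ξ-conjunct is a THEOREM (★ `evpConvention_xi_xiEvpOfRecordSC`: `tXi₀ ξ v f = 0` off `C_c(K_v\G′_v/K_v)`); the two
packet-side junk clauses on the (J2) parameters `evpG evpH` are hypotheses (P3a pins at K9). [cite: Rogawski1990, §13.7 p. 206] [cite: CartierCorvallis1979, §IV.1 Cor. 4.1] -/
theorem evpConvention_kitOfRecordSC
    (hG : ∀ (Q : 𝔰.PacketG) (v : Places L) (f : (cmDatum L 3 H).Local v → ℂ),
      ¬ (HasCompactSupport f ∧ IsLevel (cmLocalIntegralLevel L 3 H v) f) → evpG' Q v f = 0)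
    (hH' : ∀ (ρ : 𝔰.PacketH) (v : Places L) (f : (cmDatum L 3 H).Local v → ℂ),
      ¬ (HasCompactSupport f ∧ IsLevel (cmLocalIntegralLevel L 3 H v) f) → evpH' ρ v f = 0) :
    (kitOfRecord L H ι T hT μ 𝔰 gh
      (xiSideOfRecordSC L H hH hHd μω hμu μZ keys hSC hexc μv evpG' evpH' ramG' ramH' PiXi' ρXi')
      μω c jInf dsInf archTr ν μv ramCls₀).EvpConvention := by
  letI : ∀ v : HeightOneSpectrum (𝓞 ↥(maximalRealSubfield L)), MeasurableSpace ((cmDatum L 3 H).Local v) := fun _ => borel _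
  exact ⟨hG, hH', evpConvention_xi_xiEvpOfRecordSC L H hH hHd μω hμu μZ keys hSC μv⟩

end Laws

/-! ## §4 Row #21 with the letter (L-i′) BY NAME -/

section Letter

variable [∀ v : HeightOneSpectrum (𝓞 ↥(maximalRealSubfield L)), BorelSpace (Gqs L v ⧸ Subgroup.center (Gqs L v))]
  [∀ v : HeightOneSpectrum (𝓞 ↥(maximalRealSubfield L)), (μZ v).IsHaarMeasure]
  (hquad : ∀ v : HeightOneSpectrum (𝓞 ↥(maximalRealSubfield L)), (∀ w : PlacesOver L v, IsCMField.complexConj L • w.1 = w.1) →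
    IsQuadraticCharExtension (conjLocal L (IsCMField.complexConj L) v) (μω.semilocalComponent L v))
  (ι : L →+* ℂ) (T : GL (Fin 3) ℂ)
  (hT : (T : Matrix (Fin 3) (Fin 3) ℂ)ᴴ * H.map ι * (T : Matrix (Fin 3) (Fin 3) ℂ) = Literature.Geometry.ComplexHyperbolic.BallModel.J)
  (μ : Measure (Gp L H).automorphicQuotient) [(Gp L H).IsAutomorphicMeasure μ]
  [MeasurableSpace (Gp L H).Adelic] [BorelSpace (Gp L H).Adelic]
  (𝔰 : Sockets L H μ) (gh : GHSide L H ι T hT 𝔰.PacketG 𝔰.PacketH)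
  (evpG' : 𝔰.PacketG → EvpData L H) (evpH' : 𝔰.PacketH → EvpData L H) (ramG' : 𝔰.PacketG → Finset (Places L)) (ramH' : 𝔰.PacketH → Finset (Places L))
  (PiXi' : OneDimAutRepH L → 𝔰.PacketG) (ρXi' : OneDimAutRepH L → 𝔰.PacketH)
  (c : ℚ) (jInf dsInf : ℤ → ℤ → ℤ → Cinf)
  (archTr : Cinf → (UnitaryGroup.arch (↥(maximalRealSubfield L)) L (IsCMField.complexConj L) 3 H → ℂ) → ℂ)
  (ν : Measure (Gp L H).Adelic) [IsFiniteMeasureOnCompacts ν]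
  (ramCls₀ : DiscreteAutomorphicRep (Gp L H) μ → Set (Places L))

/-- **Row #21 at `𝔠₀` FROM THE LETTER (L-i′)** `hLi : XiPinSphericalCofinite L` (books row #79): with `hexc₀ ξ := hexc_of_xiPinSphericalCofinite L μω hμu μZ keys hquad hLi ξ`
(★ p820148) as the record's `hexc`, law `XiUnram` holds at `𝔠₀`. [cite: Rogawski1990, §13.3 Thm. 13.3.6 (b) p. 202; §12.2 pp. 173–174; §13.7 p. 206] -/
theorem xiUnram_kitOfRecordSC_of_xiPinSphericalCofinite (hLi : XiPinSphericalCofinite L)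
    (hμv : ∀ v : Places L, letI : MeasurableSpace ((cmDatum L 3 H).Local v) := borel _; (μv v).IsHaarMeasure) :
    (kitOfRecord L H ι T hT μ 𝔰 gh
      (xiSideOfRecordSC L H hH hHd μω hμu μZ keys hSC
        (fun ξ => hexc_of_xiPinSphericalCofinite L μω hμu μZ keys hquad hLi ξ) μv evpG' evpH' ramG' ramH' PiXi' ρXi')
      μω c jInf dsInf archTr ν μv ramCls₀).XiUnram :=
  xiUnram_kitOfRecordSC L H hH hHd μω hμu μZ keys hSC _ μv ι T hT μ 𝔰 gh evpG' evpH' ramG' ramH' PiXi' ρXi'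
    c jInf dsInf archTr ν ramCls₀ hμv

end Letter


end Side

/-! ## §5 `hFinU` at `ξd₀ˢᶜ` from the letter «XiLocalPacketUnitary» (★ `F0P3LettersXiLocalPacketUnitary` §2 with `hCM ↦ hSC`) -/

section GlueU

variable (L : Type) [Field L] [NumberField L] [IsCMField L] (H : Matrix (Fin 3) (Fin 3) L)
variable (hH : (H.map (cmConjRingHom L))ᵀ = H) (hHd : IsUnit H.det) (μω : HeckeCharacter L) (hμu : μω.IsUnitary)
  [∀ v : HeightOneSpectrum (𝓞 ↥(maximalRealSubfield L)), MeasurableSpace (Gqs L v ⧸ Subgroup.center (Gqs L v))]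
  (μZ : ∀ v : HeightOneSpectrum (𝓞 ↥(maximalRealSubfield L)), Measure (Gqs L v ⧸ Subgroup.center (Gqs L v)))
  (keys : ∀ (ξ : OneDimAutRepH L) (v : HeightOneSpectrum (𝓞 ↥(maximalRealSubfield L))),
    (∀ w : PlacesOver L v, IsCMField.complexConj L • w.1 = w.1) →
      {p : IrrClass (Gqs L v) × IrrClass (Gqs L v) //
        KeysCaseTwoLabels L v (μω.semilocalComponent L v) (torusLocalComponent L (IsCMField.complexConj L) v ξ.η)
          (torusLocalComponent L (IsCMField.complexConj L) v ξ.ψ) p.1 p.2 ∧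
        p.1.IsSquareIntegrable (μZ v) ∧ ¬ p.2.IsSquareIntegrable (μZ v)})

/-! ## §2 GLUE: `hFinU` for the packet of record (F0P3b's h10 `unitaryPacket_kitOfRecord_of … hFinU hJU hDU`) -/

variable
  (hSC : letI : ∀ v : HeightOneSpectrum (𝓞 ↥(maximalRealSubfield L)), MeasurableSpace ((cmDatum L 3 H).Local v) := fun _ => borel _
    ∀ (ξ : OneDimAutRepH L) (v : HeightOneSpectrum (𝓞 ↥(maximalRealSubfield L)))
    (hns : ∀ w : PlacesOver L v, IsCMField.complexConj L • w.1 = w.1)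
    (T : GL (Fin 3) (LocalRing L v)) (a : LocalRing L v) (ha : IsUnit a)
    (h : formCongr (conjLocal L (IsCMField.complexConj L) v) T (H.map (algebraMap L (LocalRing L v))) =
      a • (Matrix.of fun i j : Fin 3 => if i.val + j.val + 1 = 3 then (1 : L) else 0).map (algebraMap L (LocalRing L v)))
    (π2 πn : IrrClass (Gqs L v)),
    KeysCaseTwoLabels L v (μω.semilocalComponent L v) (torusLocalComponent L (IsCMField.complexConj L) v ξ.η)
      (torusLocalComponent L (IsCMField.complexConj L) v ξ.ψ) π2 πn → ¬ πn.IsSquareIntegrable (μZ v) →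
    ∃ πs : IrrClass ((cmDatum L 3 H).Local v), πs.IsSupercuspidal ∧ πs ≠ IrrClass.comap (cmDatumLocalCongr L v T ha h).symm πn)

/-- **`hFinU` FROM THE LETTER**: every member of the finite packet of record `xiPacketFamilyOfRecordSC … ξ v` (★ p819611) is unitarizable — split: ★ `xiPacketFamilyOfRecordSC_of_split`
(member (i) of the letter; `πs = none`); non-split: ★ `xiPacketFamilyOfRecordSC_of_nonsplit` — `πn = comap (…) (keys ξ v hns).πn` by (ii) + ★ `isUnitarizable_comap`, `πs` supercuspidal
(★ `CMNonsplitCharIdentityAt.πs_isSupercuspidal`) hence unitarizable by (iii). [cite: Rogawski1990, §12.2 (1)–(2) pp. 173–174; §13.1 Prop. 13.1.3 (d) p. 199] -/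
theorem hFinU_of_xiLocalPacketUnitarySC (hXU : XiLocalPacketUnitary L H hH hHd μω hμu μZ keys) :
    letI : ∀ v : HeightOneSpectrum (𝓞 ↥(maximalRealSubfield L)), MeasurableSpace ((cmDatum L 3 H).Local v) := fun _ => borel _
    ∀ (ξ : OneDimAutRepH L) (v : Places L),
      (xiPacketFamilyOfRecordSC L H hH hHd μω hμu μZ keys hSC ξ v).πn.IsUnitarizable ∧
        ∀ s : IrrClass ((cmDatum L 3 H).Local v),
          (xiPacketFamilyOfRecordSC L H hH hHd μω hμu μZ keys hSC ξ v).πs = some s → s.IsUnitarizable := by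
  letI : ∀ v : HeightOneSpectrum (𝓞 ↥(maximalRealSubfield L)), MeasurableSpace ((cmDatum L 3 H).Local v) := fun _ => borel _
  intro ξ v
  by_cases hs : ∃ w : PlacesOver L v, IsCMField.complexConj L • w.1 ≠ w.1
  · rw [xiPacketFamilyOfRecordSC_of_split L H hH hHd μω hμu μZ keys hSC ξ v hs]
    refine ⟨hXU.1 ξ v hs, fun s hs' => ?_⟩
    rw [cmSplitPacket_πs] at hs'
    exact absurd hs' (by simp)
  · have hns : ∀ w : PlacesOver L v, IsCMField.complexConj L • w.1 = w.1 := fun w => not_not.1 fun hw => hs ⟨w, hw⟩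
    obtain ⟨T', a, ha, hT', hP, -⟩ := xiPacketFamilyOfRecordSC_of_nonsplit L H hH hHd μω hμu μZ keys hSC ξ v hns
    rw [hP]
    refine ⟨isUnitarizable_comap _ (hXU.2.1 ξ v hns), fun s hs' => ?_⟩
    obtain rfl := Option.some_injective _ hs'
    exact hXU.2.2 v hns _ (Exists.choose_spec (hSC ξ v hns T' a ha hT' (keys ξ v hns).1.1 (keys ξ v hns).1.2 (keys ξ v hns).2.1 (keys ξ v hns).2.2.2)).1

variable (hexc : ∀ ξ : OneDimAutRepH L, ∀ᶠ v : HeightOneSpectrum (𝓞 ↥(maximalRealSubfield L)) in Filter.cofinite,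
      ∀ hns : ∀ w : PlacesOver L v, IsCMField.complexConj L • w.1 = w.1,
        ((keys ξ v hns).1.2).IsSpherical (cmLocalIntegralLevel L 3 (qsForm L) v))
  (μv : ∀ v : Places L, @Measure ((cmDatum L 3 H).Local v) (borel _))
  {PG PH : Type} (evpG : PG → EvpData L H) (evpH : PH → EvpData L H) (ramG : PG → Finset (Places L)) (ramH : PH → Finset (Places L))
  (PiXi : OneDimAutRepH L → PG) (ρXi : OneDimAutRepH L → PH)

/-- **`hFinU` AT THE ξ-SIDE OF RECORD `ξd₀ := xiSideOfRecordSC …`** — literally the `hFinU` binder of F0P3b's `unitaryPacket_kitOfRecord_of` at `ξd := ξd₀` (`ξd₀.packFin = xiPacketFamilyOfRecordSC …`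
by `rfl`). [cite: Rogawski1990, §12.2 (1)–(2) pp. 173–174; §13.1 Prop. 13.1.3 (d) p. 199] -/
theorem hFinU_xiSideOfRecordSC (hXU : XiLocalPacketUnitary L H hH hHd μω hμu μZ keys) :
    letI : ∀ v : HeightOneSpectrum (𝓞 ↥(maximalRealSubfield L)), MeasurableSpace ((cmDatum L 3 H).Local v) := fun _ => borel _
    ∀ (ξ : OneDimAutRepH L) (v : Places L),
      ((xiSideOfRecordSC L H hH hHd μω hμu μZ keys hSC hexc μv evpG evpH ramG ramH PiXi ρXi).packFin ξ v).πn.IsUnitarizable ∧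
        ∀ s : IrrClass ((cmDatum L 3 H).Local v),
          ((xiSideOfRecordSC L H hH hHd μω hμu μZ keys hSC hexc μv evpG evpH ramG ramH PiXi ρXi).packFin ξ v).πs = some s →
            s.IsUnitarizable :=
  hFinU_of_xiLocalPacketUnitarySC L H hH hHd μω hμu μZ keys hSC hXU

end GlueU

end Summit.HodgeConjecture.HodgeConjecture.Cruxes.H413.F0P3XiSideOfRecordSC
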